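import Summits.HodgeConjecture.HodgeConjecture.Cruxes.SheafSeedGaussSq.Lines.secant_q824
import Summits.HodgeConjecture.HodgeConjecture.Theorems.SheafSeedGaussSq.Negative.SecantTranslatesGeneralPosition
import Summits.HodgeConjecture.HodgeConjecture.Theorems.SheafSeedGaussSq.Negative.SecantPlaneSplitCensus
import Summits.HodgeConjecture.HodgeConjecture.Theorems.SheafSeedGaussSq.Negative.SecantSemiregularEulerSqueeze
import Summits.HodgeConjecture.HodgeConjecture.Theorems.SheafSeedGaussSq.Negative.SecantContractionRankCertificate
import Summits.HodgeConjecture.HodgeConjecture.Theorems.SheafSeedGaussSq.Negative.WeilSquaredLetterRankCertificate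
import Literature.AlgebraicGeometry.Motives.FourTranslatesMeet
import Literature.AlgebraicGeometry.HodgeTheory.SemiregularityEulerFormBarrier
import HarnessLib

/-!
**v4.2** (generation 2 of the standing disprover: §G NEW — director req-153 (1) statement audit A1–A6 + catalogue tests; §E–§F NEW — the crux idea cards `weil-squared-anchor` (node
`WeilSquaredAnchorNode.lean`; NOT imported: a file importing it gets `lean check` rc 75 «farm unavailable» as of 2026-08-31, so the
leaf instance below is stated against a verbatim copy of the leaf's hypotheses) and `cusp-log-seed` attacked per director R19.585; v3 = generation 1, imports the line file
`Lines/secant_q824.lean` **v5** `0796acf30e149dbd` and the LANDED negative modules; v2 no longer elaborated against v5 because the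
datum field `generalPosition` was re-typed — see §A).

# Disproof of `SheafSeedGaussSq` (stmt-HodgeConjecture-30548) — findings of the standing disprover

Crux (route `EightfoldTwistedSheafSeeds`, verbatim):
`SheafSeedGaussSq := ∃ m : ℕ, 0 < m ∧ ∀ C : ChernCharacterBetti, HasHyperbolicSeedOn (twistedReflexiveClass C AdmTw') 4 (m ^ 2)`,
`AdmTw' = gluableSigmaAdmissible ∨ bfSingleAdmissible'` (`SecantQ824.AdmTwP`).

NOTHING in this file asserts HC / HC_AV / HC_CM / WeilSixfolds / stmt-18881 / stmt-30548, and the crux is NOT refuted: every crux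
and stub statement is headed by `∀ C : ChernCharacterBetti`, a structure the tree cannot inhabit today, so NO unconditional `¬` of
the crux or of a `∀ C`-stub is typable — `sheafSeedGaussSq_of_isEmpty` (§C) records the converse. All kills below are therefore
(i) unconditional statements about line data not mentioning `C`, or (ii) implications modulo a precise derived fact `H`, or
(iii) refutations of NATURAL STRENGTHENINGS of a stub.

## Findings (index)

* §E — **NEW (g2): crux idea card `weil-squared-anchor` — its three cheapest falsifiers RUN, the eightfold `e₂`-law CORRECTED,
  two typed necessary conditions for its K-leaf.** Exact GRR over `ℚ(i)` for Orlov's `Φ = (id × Φ_{𝒫⁻¹[2]}) ∘ μ^*`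
  [Markman 2502.03415 §6.1] in the split rational model of `B = X₂ × X̂₂` (refuter scripts `compute/weil_squared_fourfold.py`,
  `compute/weil_squared_eightfold.py`; validation: `φ(ℓ ⊗ ℓ̄) = −u₊ ∧ e^{c/2}`, `φ(ℓ ⊗ ℓ) = −4·exp(½(ih + c))` — pure spinors go to
  pure spinors; `Φ(𝒪 ⊠ 𝒪) ≃ 𝒪_{X×pt}` gets `(f₁,f₂) = (4,6) = (e₁?,e₂)` of a sub-torus). (a) `κ(E₂) = ch Φ(I_p ⊠ I_q^∨)
  = −e^{c/2} ∧ (2 − h²/4 + h⁴/192 + (c² − (Θ−Θ̂)²)/4)`, rank `−2`, Weil coefficients `(−¼,−¼)` (`u₊ + u₋ = c² − (Θ−Θ̂)²`), and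
  `(f₁,f₂,f₃,f₄) = (8,18,8,1)` against `e(E₂) = (1,4,1)^{⊗2} = (1,8,18,8,1)`: `f₂ = e₂` ⇒ `ob²` onto ⇒ `σ² = (ob²)ᵀ` injective —
  **the card's letter `E₂` PASSES (a): fully `σ`-semiregular and taut at the special point** (modulo [BF08] 6.4.4 + the duality
  transpose); KERNEL CERTIFICATE `rank_M1_kappaE2 = 8`, `rank_M2_kappaE2 = 18` in `Theorems/SheafSeedGaussSq/Negative/
  WeilSquaredLetterRankCertificate.lean` (p799944 ACCEPTED, g2; imported, see §E). Among `Φ(I_Z ⊠ I_{Z'}^∨)` (all `f₂ = 18`) the `e₂`-law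
  `2 + (2d₁+2)(2d₂+2) = 18` holds only at `d₁ = d₂ = 1`; `Φ(𝒪 ⊠ I_q^∨)` (`(6,10)`, `e₂ = 10`) and `Φ(Θ^a ⊠ Θ̂^b)` (`(4,6)`) pass too.
  Fourfold table `(f₁,f₂)`: `u (8,12) · 1, pt, e^h (4,6) · h, h³ (8,12) · h² (8,18) · 1+u, e^h+u (8,16) · h+u (8,20) · h²+αu₊+βu₋ (8,24)`
  generically, dropping to `23` on `αβ = t²`, `22` on `4αβ = t²`, `21` if `αβ = 0` (`κ = t h² + αu₊ + βu₋`; the card printed 24).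
  (b) LINEAR KÜNNETH PRE-TEST, settled as a RANK LAW: a K-shaped `T = T_h + T_W ∈ (ℚ[h]⊗ℚ[h]) ⊕ (W⊗W)` is block-diagonal, so
  `#letters ≥ rank T_h + 2`; two letters ⇒ `T_h = 0` and both letters PURE WEIL classes (rank 0, `h²·κ₂ = 0`: no sheaf); three
  letters ⇒ `T_h = λ e^{th} ⊗ e^{th}` (or `1⊗1`, `h⁴⊗h⁴`) and EVERY letter in `span(e^{th}, u₊, u₋)` (row `(8,16)`); `E₂`-type letters
  (`κ ∋ c, Θ², c²`) need `≥ 4` letters with cancelling partners — otherwise the pre-test is vacuous at the special point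
  (`K₀ ↠` divisor ring, which contains `W` there). (c) `ConjugationAntiIsometry` at `k = 2`, `m = 1`, `M = G = J`: `F = diag(1,−1)`
  works (`conjugationAntiIsometry_instance_k2`, kernel-checked); leaves L0 / A / E are TRUE on paper for every rational `h`
  (degenerate hermitian forms still diagonalise; `h = 0` makes `Q ≡ 0`, any rational `Ψ`-stable 8-space is isotropic) — no leaf kill.
  EIGHTFOLD LAW (correction of the card's K3 sentence «`e₂(G) = f₂^P(κ_P(G))`»): `σ^k = (ob^{n−k})ᵀ`; on `n = 8` full `σ²`-injectivity
  ⟺ `ob⁶ : HT⁶ ↠ Ext⁶`, so `e₂ = e₆ = rank ob⁶ ≥ f₆ = f₂` and `rank ob² = f₂` — equality `e₂ = f₂` is the FOURFOLD law only. Eightfold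
  K-shape table `(f₁,f₂,f₃,f₄)` (rigid 16-generator model, `h = Σ aₖāₖ + bₖb̄ₖ`, `w± = ∧⁸V_{±i}`): generic `Σcₚhᵖ + αw₊ + βw₋`
  `(16,104,304,480)`; `e^h + w`, `1 + w` `(16,72,160,208)`; `h² + w`, `h⁶ + w` `(16,104,256,344)`; `h + w` `(16,88,208,276)`; `w` alone
  `(16,56,112,140)`; `ℚ[h]` alone `(16,84,224,350)`; pure spinors `(8,28,56,70)` — so ANY eightfold seed has `ob¹` injective
  (`e₁ ≥ 16`), `e₂ ≥ 104` (resp. `≥ 72`), `e₃ ≥ 304`, `e₄ ≥ 480` in the generic shape. (S1′) ORLOV IMAGES OF BOX PRODUCTS on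
  `X₄ × X̂₄`: `char⁶_{Φ(F₁⊠F₂^∨)} = ⊕_{a+b=6} char^a_{F₁} ⊗ char^b_{F₂^∨}` (Künneth for `HH`, `∧`-generation) is onto iff `char^{2,3,4}`
  of BOTH factors are onto, i.e. both factors `σ²`-, `σ¹`- AND `σ⁰`-semiregular on `X₄` ⇒ `e₀ ≥ 3` each by §D: that supply is dead
  (sharpens O2/(S1)). (N1) GLUING CONSTRAINT: for a triangle `L₁ → G → L₂ → L₁[1]` on `P` with `ω_P ≅ 𝒪` and `σ²_G` injective, the map
  `Ext²(L₂,L₁) → Ext²(G,G)`, `e ↦ i∘e∘p`, is ZERO (naturality `p∘char_G(ξ)∘i = char_{L₂}(ξ)∘p∘i = 0` + Serre–trace duality); split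
  case = the cell's (C1)–(C3); dimension form `ext²(L₂,L₁) ≤ ext¹(L₁,L₁) + ext¹(L₂,L₂) + ext¹(L₁,L₂)` KILLS every self-extension of a
  Künneth square `L = E ⊠ E′` of `E₂`-type letters (`100 ≤ 48` false: `n1dim_selfExtension_E2sq_false`); letters at distinct points
  have `Ext¹(L₂,L₁) = 0` (no gluing at all). Net for the K-leaf `WeilSquaredSupply`: UNDECIDED, now fenced by (N1), the rank law (b),
  (S1′) and the `≥`-only eightfold law.
* §F — **NEW (g2): crux idea card `cusp-log-seed`** — N0 (`K`-shape ⇒ cusp position) is automatic on MT-generic members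
  (`B•(P_gen) = ℚ[h] ⊕ W_K`, `W_K ⊂ H⁸` only, `h ∪ W_K = 0`: lit №311 / `h ∧ w± = 0` in the model above), so it constrains nothing there;
  N1 leaves (`CuspMiddleWeight`, `CuspWeightExact`, `CuspTopVanishing`) hold in the rigid model for every `N ≥ 1` by inspection
  (`w₊ = ∧^N L₊ ∧ ∧^N(V_i/L₊)`, `∧^N L₋ ∧ w₊ ≠ 0`, `∧^{2N}L ∧ w± = 0`; isotropy unused) — at `N = 0` `CuspTopVanishing` would read
  `w = 0` on `H⁰`, so a registered version wants `0 < N`; the N = 2 toy (N4, cellular `σ^{log}` ranks) is NOT runnable here (incarnation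
  recipe undefined on the card, kit 0) — recorded, not run. No kill, no lemma.
* §G — **NEW (g2): req-153 (1) statement audit** — 0 blocking / 2 non-blocking: (R-i) door index asymmetry {1..8} (gluable, full σ) vs
  {1..4} (bfSingle', partial σ) — typed lemmas `gluable_index_full`, `bfSingle'_index_floor`; (R-ii) `∀ C` = ℚ^×-rescaling torsor, covariant,
  uninstantiated ⇒ refutable only modulo K1. Junk E = 0 excluded by w ≠ 0 (character separation at (x,y) = (2,1), three `decide`s). The three
  catalogue entries (p796089, p796093, LAW #2 p796927) have NO kernel contact with the crux's predicates (abstract linear algebra on a fourfold);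
  pen: they close the Jacobian-letter / odd-theta-letter / (with (S1′)) Orlov-box sub-doors of R4; R1–R3 are not expressible in the predicate;
  `bfSingleAdmissible'` not vacuous as typed but empty of candidates. Full text `AUDIT-req153.md`.
* §D — **NEW (g1), THE HEADLINE: the Euler squeeze / «Question 8.2.4: NO».** The computation cell `pub-hsemireg` SIGNED on
  2026-08-22 (HOME `step0/C/Q824-NO.md` v2, `step0/C/NOGO-n4.md` §2, §8, §9; owner s0-3, referee ✓✓, second proof via
  Lombardi–Tirabassi) its NEGATIVE #1: on an abelian FOURFOLD no perfect `E` with FULL `σ` injective on `Ext²(E,E)`,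
  `Ext^{<0}(E,E) = 0`, twisted Chern character on a `K`-secant plane of a polarization and `dim Hom(E,E) ≤ 2` exists; Markman's
  `F̄′` (arXiv:2502.03415 Question 8.2.4 — THE INTENDED WITNESS of STUB 1 `stub_rung_secantObjectsQ824`, line docstring) has
  `Hom(F̄′,F̄′) = ℂ` and is therefore NOT `AdmTwP`-admissible at ANY level `d`. Mechanism (all period-free linear algebra +
  [BF08] Prop. 6.4.4 + trace duality + Serre + HRR): `σ∘ob = ⌟κ` on `HT^q`, `rank(⌟κ|HT¹) = 8`, `rank(⌟κ|HT²) = 12` for EVERY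
  non-zero class of the secant plane (twist- and isogeny-invariant; re-derived exactly by this seat, `compute/contraction_ranks.out`:
  `(f₁,f₂,f₃,f₄) = (8,12,8,1)` at all `d ∈ {1..4}`, all sampled `(x,y)`, all twists; line bundles `(4,6,4,1)`), «`σ²` injective ⟺ `ob²`
  surjective» ⇒ `e₂ = 12`, `e₁ ≥ 8`, `e₃ = e₁`, `e₄ = e₀`, `χ = 2e₀ − 2e₁ + 12 ≤ 2e₀ − 4`, and `χ = 8d(dx² + y²)∫θ⁴/(4!·deg π) > 0`
  ⇒ `dim Hom(E,E) = e₀ ≥ 3` ALWAYS; with `x = rank ∈ ℤ∖0`: at the rung `j = 1` (`d = 1`, `deg πᵢ = 2`) `e₀ ≥ 2 + 2(x²+y²) ≥ 4`, at the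
  declared fallback `j = 2` (`d = 4`, `deg πᵢ = 5`) `e₀ ≥ 15`; `F̄′` would need `e₀ ≥ 4d + 2`. Both disjuncts of `AdmTwP` test the
  FULL `σ` (all `q ≤ 3`, since `I ⊇ {0,…,4}`), i.e. exactly the cell's hypothesis; the survey's weakened Question 11.4 (`σ` injective
  on the image of `ev_E`) is NOT what `AdmTwP` encodes. TYPED HERE: `H := SecantSemiregularExtCount` (the count, positivity form,
  true for every model `C` incl. degree-rescaled ones), `admCap` (a notion capped at `dim Hom ≤ r`), and modulo `H`: no capped secant
  twisted object on any quotient of a polarized abelian fourfold (`not_hasSecantTwistedObjectOn_cap_of`), for NO datum `D` (any `j`)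
  `D.HasSecantObjects C (admCap AdmTwP r)`, `r ≤ 2` (`not_hasSecantObjects_cap_of`), the CAPPED STUB 1 is false
  (`stub_rung_cap_false_of`, modulo `H ∧ Nonempty ChernCharacterBetti`; `C`-free: `not_rung_cap_at_of`), the same for the venture's
  ORIGINAL notion `sigmaAdmissible` (`Hom = ℂ` built in: `not_hasSecantObjects_sigmaAdmissible_of`), and the EQUIVALENT REFORMULATION
  of the uncapped rung: modulo `H`, `HasSecantTwistedObjectOn C AdmTwP …` ⟺ the same for `AdmTwP ∧ 3 ≤ dim Hom(E,E)`
  (`hasSecantTwistedObjectOn_iff_nonsimple_of`) — STUB 1 as typed asks for NON-SIMPLE fully semiregular secant objects, a class for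
  which neither the preprint nor the cell has a candidate (cell NOGO-n4 §6: «no construction of E at n = 4»). The arithmetic core and
  the notion-level glue are LANDING as `Theorems/SheafSeedGaussSq/Negative/SecantSemiregularEulerSqueeze.lean` (p780392, ACCEPTED; `H`-free:
  the count is an explicit hypothesis there). The tree's Literature note `SemiregularityEulerFormBarrier.lean` has the counting WITHOUT
  the duality step (`semiregular_window_dim_four`: `χ ≤ 14`, leaving exactly `d = 1` — this line's rung — open); §D closes that window.
* §A — HISTORY (g0, landed p767842/p767843) and v5 AUDIT. v1–v4 typed `generalPosition : TranslatesInGeneralPosition …` (Markman's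
  THREEFOLD predicate: four translates DISJOINT) — empty datum modulo `FourTranslatesMeet`; the writer's v5 re-typed the field as
  `TranslatesInGeneralPositionN 4` (five empty ∧ four finite), binder-for-binder this file's `TranslatesInGeneralPosition₄` (§A′;
  `translatesInGeneralPositionN_four_iff`, `example … := D.generalPosition`). Re-running the g0 attack on v5: the five-clause is vacuous
  at `j = 1` (line: `fiveClause_levelOne`) and the four-clause asks FINITENESS of a set that is NON-EMPTY modulo `FourTranslatesMeet`
  (line: `fourClause_nonempty`) — consistent; NO new vacuity and no kill on the datum (the v4 theorems that destructured the old field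
  are withdrawn from this file; their landed explicit-binder forms in `Negative/SecantTranslatesGeneralPosition.lean` stay valid, and
  `no_levelOne_configuration_of` below records the v4 configuration kill with explicit binders).
* §B — SPLIT-OBJECT CENSUS of the secant plane (g0, landed p767958), unchanged: `≤ 3` slopes ⇒ no split witness; four slopes solve
  the class equations (so admissibility is load-bearing); census pointer `secant_rank_zero_of_three_slopes`.
* §C — WHAT ANY REFUTATION / PROOF MUST USE: `sheafSeedGaussSq_of_isEmpty` (no `C` ⇒ crux vacuously true), its contrapositive, and
  (g1) `isEmpty_chernCharacterBetti_of_rung_cap` (the capped rung at any `C` empties `ChernCharacterBetti`, modulo `H`).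
* `-- Targets`: T1 `stub_rung_secantObjectsQ824` — INTENDED WITNESS DEAD (cell NEGATIVE #1; `F̄′` not admissible at any `d`); the
  statement as typed is NOT refuted (objects with `dim End ≥ 4` are not excluded by counting) but its natural strengthening
  «… with `dim Hom(E,E) ≤ 2`» is FALSE modulo `H` at every level `j`; T2 `stub_transfer_secantQuotientEightfold` — its hypothesis
  class now consists of NON-SIMPLE objects only (modulo `H`), and the box-product/Orlov transfer additionally needs `σ¹`-injectivity
  on the factors (cell NOGO-n4 §1 (S1)/(vi)), which `HasSecantObjects` does not record; birth stubs — `∀ C`-headed, intended secant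
  witnesses equally dead by NOGO-n4 §1 (box products are never `G`-semiregular at `n = 4`, modulo the routine identity (S1)).

## HANDOFF
* Landed: p767842 (`FourTranslatesMeet`, Literature), p767843 (§A v4 kill, negative-modulo), p767958 (§B census), p780392
  (`Negative/SecantSemiregularEulerSqueeze.lean`: §D arithmetic + notion-level glue, `H`-free; ACCEPTED, imported), p781975
  (`Negative/SecantContractionRankCertificate.lean`: kernel certificate of the contraction ranks 8/12 (secant) and 4/6 (`exp θ`); ACCEPTED, imported; §D″). Evidence on the item:
  `stub_rung_secantObjectsQ824.md` (g0), `stubs/stub_rung_secantObjectsQ824_g1.md` (g1: dead witness + capped refutation),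
  `compute/secant_split_census.out`, `compute/contraction_ranks.out`.
* (g2) Proposed: `Theorems/SheafSeedGaussSq/Negative/WeilSquaredLetterRankCertificate.lean` (`rank_M1_kappaE2 = 8`,
  `rank_M2_kappaE2 = 18`, `idealPair_e2_law_iff`; `native_decide`, computational, 28 s; p799944 `--supports` this item) — import it here (§D″
  pattern) once ACCEPTED. Evidence (g2): `compute/weil_squared_fourfold.out`, `compute/weil_squared_eightfold.out`, `stubs/weil_squared_anchor_g2.md`.
* Sorried here: nothing. Non-constructive inputs: `FourTranslatesMeet` (printed), `SecantSemiregularExtCount` (derived: BF08 6.4.4 +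
  trace duality + Serre + HRR + the exterior-algebra ranks 8/12 — the cell's signed record). KERNEL CERTIFICATE of the ranks
  (`rank_M1_d1x1y1 : (M1 (kappaV 1 1 1)).rank = 8`, `rank_M2_d1x1y1 : (M2 (kappaV 1 1 1)).rank = 12`, likewise at `(1,1,0)`, `(4,1,1)`,
  and `(4,6)` for `exp(θ)`; `native_decide`, computational) LANDED as `Theorems/SheafSeedGaussSq/Negative/SecantContractionRankCertificate.lean`
  (p781975, ACCEPTED) and imported here (§D″).
* Next regimes (g2→): (4) K-leaf `WeilSquaredSupply`: push (N1) to the shared-point letters (`Ext•(L₂,L₁) = (0,2,8,2,0)`-type: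
  `24 ≤ 34` NOT killed) with the finer obstruction `Ext⁶_filt ↠ diag` (HANDOFF of the refuter NOTES §(ii)); compute `e₂ − f₂` slack
  for 4-letter gluings; (5) Weil component bookkeeping on `P = B × B^c` for `E₂ ⊠ E₂^c`-type sums (script ready); (6) if a line on
  card 2 is registered, its stubs inherit T4 below. (1) [done: p781975] rank certificate; extend it to a symbolic all-`(d,x,y)` statement if a reviewer wants more than
  the pure-spinor argument of §D; (2) if the writer moves to NON-SIMPLE witnesses
  (`dim End ≥ 4` at `j = 1`), attack with the sharper cell bound `e₁ ≥ rank ob¹` on DECOMPOSABLE objects (`E = E′ ⊕ E″` forces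
  block-diagonal `σ`, census §B pattern) and with (S1) for box products; (3) T2: type the missing `σ¹` hypothesis as a
  `_false_without_` lemma once a transfer skeleton exists.

Refuter `refuter-cdisprove-stmt-HodgeConjecture-30548-g1-0` (cdisprove g1, no kit), 2026-08-30; `…-g2-0` (cdisprove g2, no kit), 2026-08-31.
-/

noncomputable section

open CategoryTheory AlgebraicGeometry
open Literature.AlgebraicGeometry Literature.AlgebraicGeometry.Motives Literature.AlgebraicGeometry.Motives.AbelianVariety
open Literature.AlgebraicGeometry.Modules Literature.AlgebraicGeometry.KTheory
open Literature.AlgebraicGeometry.HodgeTheory Literature.AlgebraicGeometry.Markman2025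
open Literature.AlgebraicTopology.SingularHomology
open Summit.Ventures.HSemireg
open Summit.HodgeConjecture.HodgeConjecture.Cruxes.SheafSeedGaussSq.SecantQ824

namespace Summit.HodgeConjecture.HodgeConjecture.Cruxes.SheafSeedGaussSq.Disproof

-- the cell's namespace repeats the summit name, as in every crux work file
set_option linter.dupNamespace false

/-! ## §A Line `secant-q824`: HISTORY of the v1–v4 datum kill (landed p767843, fact p767842) and the v5 AUDIT

v1–v4: `generalPosition : TranslatesInGeneralPosition 𝒥.J Θ (sumSet G₁ G₂)` (any FOUR distinct translates DISJOINT — the threefold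
predicate) is unsatisfiable on the fourfold `J` modulo `FourTranslatesMeet`; the datum type was EMPTY, STUB 1 false at every `C`, STUB 2
vacuous (`Negative/SecantTranslatesGeneralPosition.lean`). v5 re-typed the field (`TranslatesInGeneralPositionN 4`: five empty ∧ four
finite); the theorems of v2 of this file that destructured the old field are WITHDRAWN (they no longer elaborate); the configuration
statement survives with explicit binders: -/

open Summit.HodgeConjecture.HodgeConjecture.Theorems.SheafSeedGaussSq.Negative
  (exists_four_translates_inter_eq_empty ne_bot_of_card_eq_sq_succ)

/-- The v1–v4 level-one configuration (`j = 1`, `#Gᵢ = 2`, all four translates `τ_0Θ, τ_{g₁}Θ, τ_{g₂}Θ, τ_{g₁+g₂}Θ` DISJOINT) does not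
exist on any dimension-4 Jacobian with a Riemann theta divisor that is a principal polarization, modulo `FourTranslatesMeet`.
(History: this killed v1–v4; v5 no longer asks it.) [folklore] -/
theorem no_levelOne_configuration_of (H : FourTranslatesMeet) {C : SchemeOver ℂ} (𝒥 : Jacobian C) (hdim : 𝒥.J.dim = 4)
    {Θ : CartierDivisor 𝒥.J.X.left} (hR : 𝒥.IsRiemannThetaDivisor Θ) (hP : 𝒥.J.IsPrincipalPolarizationDivisor Θ)
    {G₁ G₂ : Subgroup (𝒥.J.Points ℂ)} (hc₁ : Nat.card G₁ = 2) (hc₂ : Nat.card G₂ = 2) (hd : G₁ ⊓ G₂ = ⊥) :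
    ¬ TranslatesInGeneralPosition 𝒥.J Θ (sumSet G₁ G₂) := by
  intro hgp
  obtain ⟨a, -, b, -, -, -, he⟩ := exists_four_translates_inter_eq_empty hgp
    (ne_bot_of_card_eq_sq_succ (j := 1) one_pos hc₁) (ne_bot_of_card_eq_sq_succ (j := 1) one_pos hc₂) hd
  exact (H 𝒥.J Θ hdim hR.isEffective hP.isAmple 1 a b (a * b)).ne_empty he

/-! ### §A′ The writer's repair, typed (dimension-4 general position) — elaborates; NOT a Lines edit -/

/-- **Dimension-4 general position of translates** (the repair of `generalPosition` proposed in the stub-misstated note): any FIVE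
pairwise-distinct translates of `Supp Θ` by elements of `S` are disjoint, and any FOUR meet in a finite set. (Markman's
Assumption 9.2.1 (1) is the dimension-3 instance «four disjoint ∧ three finite»; on a `g`-fold the pattern is «`g+1` disjoint ∧ `g`
finite».) Typed here so the writer can paste it; whether §9's use of DISJOINTNESS of `g+1` translates survives must be re-argued on
the card. [cite: Markman2025SecantWeil, §9.2 Assumption 9.2.1 (1) and Lemma 9.3.1] -/
def TranslatesInGeneralPosition₄ (A : AbelianVariety ℂ) (Θ : CartierDivisor A.X.left) (S : Set (A.Points ℂ)) : Prop :=
  (∀ s : Fin 5 → A.Points ℂ, (∀ i, s i ∈ S) → Function.Injective s → ⋂ i, thetaTranslate A Θ (s i) = ∅) ∧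
  (∀ s : Fin 4 → A.Points ℂ, (∀ i, s i ∈ S) → Function.Injective s → (⋂ i, thetaTranslate A Θ (s i)).Finite)

/-- **At the rung `j = 1` the five-translate clause is VACUOUS**: if `S` has at most four elements (at `j = 1`,
`S = G₁G₂ = {0, g₁, g₂, g₁+g₂}`), no injective `Fin 5 → S` exists, so the repaired datum at level one only asks
«`τ_0Θ ∩ τ_{g₁}Θ ∩ τ_{g₂}Θ ∩ τ_{g₁+g₂}Θ` finite» — no new contradiction is introduced by the repair there. [folklore] -/
theorem translatesInGeneralPosition₄_clause₁_of_ncard_le_four (A : AbelianVariety ℂ) (Θ : CartierDivisor A.X.left)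
    (S : Set (A.Points ℂ)) (hS : S.Finite) (h4 : S.ncard ≤ 4) :
    ∀ s : Fin 5 → A.Points ℂ, (∀ i, s i ∈ S) → Function.Injective s → ⋂ i, thetaTranslate A Θ (s i) = ∅ := by
  intro s hs hinj
  exfalso
  have hsub : Set.range s ⊆ S := by
    rintro _ ⟨i, rfl⟩
    exact hs i
  have h5 : (Set.range s).ncard = 5 := by
    rw [Set.ncard_range_of_injective hinj, Nat.card_eq_fintype_card, Fintype.card_fin]
  have := Set.ncard_le_ncard hsub hS
  omega

/-- **v5 audit**: the line's `TranslatesInGeneralPositionN 4` IS this file's `TranslatesInGeneralPosition₄`, by `Iff.rfl`.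
[cite: Markman2025SecantWeil, §9.2 Assumption 9.2.1 (1) and Lemma 9.3.1] -/
theorem translatesInGeneralPositionN_four_iff (A : AbelianVariety ℂ) (Θ : CartierDivisor A.X.left) (S : Set (A.Points ℂ)) :
    TranslatesInGeneralPositionN 4 A Θ S ↔ TranslatesInGeneralPosition₄ A Θ S :=
  Iff.rfl

/-- **v5 audit**: the repaired field of a datum, read as the dimension-4 predicate (no new vacuity: at `j = 1` its five-clause is the
line's `fiveClause_levelOne`, its four-clause is finiteness of a set that is non-empty modulo `FourTranslatesMeet` — the line's
`fourClause_nonempty`). [cite: Markman2025SecantWeil, §9.3 Lemma 9.3.1 (proof)] -/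
example (D : GenusFourSecantDatum) : TranslatesInGeneralPosition₄ D.𝒥.J D.Θ (sumSet D.G₁ D.G₂) :=
  D.generalPosition

/-- **v5 audit, modulo `FourTranslatesMeet`**: the four-clause of the repaired field is never an EMPTINESS statement — every four
translates of the datum's `Θ` meet; so finiteness is the whole content (consistent with the product model of the line's §2b).
[cite: MumfordAV1970, §6 Application 1 and §16] -/
theorem fourClause_content_of (H : FourTranslatesMeet) (D : GenusFourSecantDatum) (t : Fin 4 → D.𝒥.J.Points ℂ)
    (ht : ∀ i, t i ∈ sumSet D.G₁ D.G₂) (hinj : Function.Injective t) :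
    (⋂ i, thetaTranslate D.𝒥.J D.Θ (t i)).Finite ∧ (⋂ i, thetaTranslate D.𝒥.J D.Θ (t i)).Nonempty :=
  ⟨D.generalPosition.2 t ht hinj, D.fourClause_nonempty H t⟩

/-! ## §B Split-object census of the secant plane (memo §3) — LANDED as
`Theorems/SheafSeedGaussSq/Negative/SecantPlaneSplitCensus.lean` (p767958): `secantMoments_three_slopes`,
`secantMoments_three_slopes_rank_zero`, `secantMoments_nonneg`, `secantMoments_four_slopes_example`,
`momentMatrix_four_columns_dependent` (imported above; exact table `compute/secant_split_census.out` in the item's evidence). -/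

/-- Census pointer (re-export under this work file's namespace): with `≤ 3` slopes the rank on the secant plane is `0`.
[folklore] -/
theorem secant_rank_zero_of_three_slopes {d t₁ t₂ t₃ N₁ N₂ N₃ : ℚ} (hd : 0 < d) (h₁₂ : t₁ ≠ t₂) (h₁₃ : t₁ ≠ t₃)
    (h₂₃ : t₂ ≠ t₃)
    (e₂ : N₁ * t₁ ^ 2 + N₂ * t₂ ^ 2 + N₃ * t₃ ^ 2 = -d * (N₁ + N₂ + N₃))
    (e₃ : N₁ * t₁ ^ 3 + N₂ * t₂ ^ 3 + N₃ * t₃ ^ 3 = -d * (N₁ * t₁ + N₂ * t₂ + N₃ * t₃))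
    (e₄ : N₁ * t₁ ^ 4 + N₂ * t₂ ^ 4 + N₃ * t₃ ^ 4 = d ^ 2 * (N₁ + N₂ + N₃)) :
    N₁ + N₂ + N₃ = 0 :=
  Summit.HodgeConjecture.HodgeConjecture.Theorems.SheafSeedGaussSq.Negative.secantMoments_three_slopes_rank_zero
    hd h₁₂ h₁₃ h₂₃ e₂ e₃ e₄

/-! ## §D (g1) THE EULER SQUEEZE — the cell's NEGATIVE #1 «Question 8.2.4: NO», typed

Source of record (HOME `run/shared/lean/pub/pub-hsemireg`): `step0/C/Q824-NO.md` v2 (2026-08-22: THEOREM — no fully semiregular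
secant-plane object with `dim Hom ≤ 2` on an abelian fourfold `Y = X/G`, `G ⊂ X[d+1]` cyclic of order `d+1`; COROLLARY — Markman's
`F̄′` of Question 8.2.4 is not semiregular, «Q824: NO»), `step0/C/NOGO-n4.md` (§1 box products never `G`-semiregular at `n = 4`
modulo (S1); §3 rank table `rank(⌟α|HT²) = 12 < Σ_G = 14` at `n = 4`; §8 the duality (S2) `⟨σ^q(e), ξ⟩ = (−1)^{|e||ξ|} Tr(e∘ob^q(ξ))`
from the compatibility of the trace with contraction, [BF03] proof of Prop. 4.2, formula (1); §9 universality of the ranks `8, 12` over the whole secant plane, all `d`, all twists).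
This seat re-derived the rank table exactly (`compute/contraction_ranks.out`, pure `ℚ(i)` linear algebra in `∧^•ℚ⁸`).

RANK TABLE — PROOF (pure-spinor calculus; replaces «three codes»). `H¹(A;ℂ) = W ⊕ W̄` (`W = H^{1,0}`, symplectic basis `wᵢ, w̄ᵢ`,
`θ = Σᵢ wᵢ∧w̄ᵢ` up to a scalar absorbed below), `H^•(A) = ∧^•(W ⊕ W̄)`, `HT^q(A) = ∧^q(W̄ ⊕ W^*)` acting by `w̄ᵢ∧` and the derivations
`ιᵢ = ∂/∂wᵢ ⌟`; `HT^• = ∧^•HT¹` acts as a supercommutative algebra (`HT¹` is Clifford-isotropic). Put `φ_λ = exp(λθ) = Πᵢ(1 + λwᵢw̄ᵢ)`.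
Then `ιᵢφ_λ = λ·w̄ᵢ∧φ_λ`, hence `(w̄_I ι_J)⌟φ_λ = ±λ^{|J|}·w̄_{I⊔J}∧φ_λ` (zero if `I ∩ J ≠ ∅`): `HT^q·φ_λ = span{w̄_T∧φ_λ : |T| = q}`, of
dimension `C(4,q)` — a pure spinor has `(f₁,f₂,f₃,f₄) = (4,6,4,1)`. A non-zero REAL point of the `K`-secant plane is
`κ = aφ_λ + āφ_λ̄`, `λ = √-d·c ∉ ℝ`, `a ≠ 0` (in the line's coordinates `a = (x − iy/√d)/2`); a `B`-field twist `exp(βθ)` replaces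
`(λ, λ̄)` by `(λ+β, λ̄+β)`, still two DISTINCT parameters `λ ≠ μ`. For `κ = aφ_λ + bφ_μ`, `ab ≠ 0`, `λ ≠ μ`:
`(w̄_I ι_J)⌟κ = ±(aλ^j·w̄_Tφ_λ + bμ^j·w̄_Tφ_μ)`, `T = I ⊔ J`, `j = |J| ∈ {0,…,|T|}` all realised; already `j = 0, 1` give
`det [[a, b],[aλ, bμ]] = ab(μ − λ) ≠ 0`, so `HT^q·κ = ⊕_{|T| = q} span{w̄_Tφ_λ, w̄_Tφ_μ}` for `q ≥ 1`. For `|T| ≤ 3`,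
`w̄_Tφ_λ − w̄_Tφ_μ = (λ − μ)·w̄_T∧(Σ_{i∉T} wᵢw̄ᵢ + …) ≠ 0` and distinct `T` have distinct `w̄`-leading terms, so `f_q = 2·C(4,q)`:
**`f₁ = 8`, `f₂ = 12`, `f₃ = 8`**; for `T = {1,2,3,4}` both vectors equal `w̄_T`, so `f₄ = 1`. A general twist `b ∈ H²` and an isogeny
pull-back conjugate `ξ⌟` by automorphisms of each `HT^q` (`exp(ad b)`, `dπ`), so the ranks are twist- and isogeny-invariant. With
`dim HT²(B) = h²(𝒪) + h¹(T) + h⁰(∧²T) = 6 + 16 + 6 = 28`: if `σ²` is injective then `ob² : HT² → Ext²(E,E)` is onto (duality (S2)) and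
`e₂ = rank ob² = rank(σ²ob²) = f₂ = 12`, while `e₁ ≥ rank ob¹ ≥ f₁ = 8`. ∎

The count is typed as ONE closed `Prop` `H := SecantSemiregularExtCount` in POSITIVITY form (`e₁ ≤ e₀ + 5`, i.e. `χ ≥ 2`; the exact
value of `χ` is deliberately not asserted, so that `H` holds for EVERY model `C : ChernCharacterBetti`, including degree-rescaled ones,
memo bc5g18 §3 v1.2). Everything below is sorry-free modulo `H`. The `H`-free kernel content (arithmetic + notion-level glue) is the
landing `Theorems/SheafSeedGaussSq/Negative/SecantSemiregularEulerSqueeze.lean` (p780392, accepted). -/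

/-- **An admissibility notion CAPPED at `dim Hom(E,E) ≤ r`** (`extRank X₀ E 0 ≤ r`): `admCap AdmTwP 1` contains every witness with
`Hom(E,E) = ℂ` — Markman's `F̄′`, every simple sheaf, every `sigmaAdmissible` complex. [cite: BuchweitzFlenner2003, §5 (I-semiregular)] -/
def admCap (Adm : PerfectAdmissibility) (r : ℕ) : PerfectAdmissibility :=
  fun n X₀ I E => Adm n X₀ I E ∧ extRank X₀ E 0 ≤ (r : Cardinal)

/-- The capped notion implies the notion. [folklore] -/
theorem admCap_le (Adm : PerfectAdmissibility) (r : ℕ) : ∀ n X₀ I E, admCap Adm r n X₀ I E → Adm n X₀ I E :=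
  fun _ _ _ _ h => h.1

/-- `HasSecantTwistedObjectOn` is monotone in the admissibility notion. [folklore] -/
theorem hasSecantTwistedObjectOn_mono {Adm Adm' : PerfectAdmissibility} (hle : ∀ n X₀ I E, Adm n X₀ I E → Adm' n X₀ I E)
    {C : ChernCharacterBetti} {d : ℕ} {A B : AbelianVariety ℂ} {π : A ⟶ B} {θ : complexBetti A.X 2}
    (h : HasSecantTwistedObjectOn C Adm d A B π θ) : HasSecantTwistedObjectOn C Adm' d A B π θ := by
  obtain ⟨I, κ, x, y, hI, hcl, hx, hpin⟩ := h
  exact ⟨I, κ, x, y, hI, hcl.mono hle, hx, hpin⟩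

/-- `HasSecantObjects` is monotone in the admissibility notion. [folklore] -/
theorem hasSecantObjects_mono {Adm Adm' : PerfectAdmissibility} (hle : ∀ n X₀ I E, Adm n X₀ I E → Adm' n X₀ I E)
    {C : ChernCharacterBetti} (D : GenusFourSecantDatum) (h : D.HasSecantObjects C Adm) : D.HasSecantObjects C Adm' := by
  obtain ⟨θ₀, hθ, h₁, h₂⟩ := h
  exact ⟨θ₀, hθ, hasSecantTwistedObjectOn_mono hle h₁, hasSecantTwistedObjectOn_mono hle h₂⟩

/-- Sanity: the CAPPED rung implies the rung (so refuting the capped rung refutes a STRENGTHENING, not a weakening). [folklore] -/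
theorem hasSecantObjects_of_cap {C : ChernCharacterBetti} (D : GenusFourSecantDatum) (r : ℕ)
    (h : D.HasSecantObjects C (admCap AdmTwP r)) : D.HasSecantObjects C AdmTwP :=
  hasSecantObjects_mono (admCap_le AdmTwP r) D h

/-- **`H` — THE SECANT SEMIREGULAR EXT-COUNT ON AN ABELIAN FOURFOLD** (the cell's NEGATIVE #1 in positivity form). For an isogeny
`π : A → B` of complex abelian varieties with `dim A = 4`, an ample `Θ` on `A` with polarization class `θ ∈ ℚ^×·[Θ]`, a level
`d > 0`, and a bounded complex of vector bundles `E` on `B` that is `AdmTwP`-admissible at an index set `I ⊇ {0,…,4}` (FULL `σ`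
injective on `Ext²(E,E)`, `Ext^{<0}(E,E) = 0`) and whose `B₀`-twisted classes pull back to the secant plane
(`π^*κ_p = (x·secRe d p + y·secIm d p)·θᵖ` for `p ∈ I`, `x ≠ 0`): `dim Ext²(E,E) = 12`, `dim Ext¹(E,E) ≥ 8` and
`dim Ext¹(E,E) ≤ dim Hom(E,E) + 5` (the last is `χ(E,E) = 2e₀ − 2e₁ + 12 ≥ 2`, from `χ = 8d(dx²+y²)·∫_Aθ⁴/(4!·deg π) > 0`).
Derivation (cell NOGO-n4.md §2/§8/§9, Q824-NO.md Proof 1): `σ_E∘ob_E = ⌟(exp(B₀)ch(E))` on `HT^q(B)` [BF08 Prop. 6.4.4/Thm. 6.4.2], whose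
rank is `8` on `HT¹` and `12` on `HT²` for every non-zero secant class (conjugation by `exp(b)`, `b ∈ H²`, and isogeny pull-back preserve
the ranks); `⟨σ²(e), ξ⟩_Serre = ±Tr(e∘ob²(ξ))` (the trace commutes with contraction: [BF03] proof of Prop. 4.2, formula (1); then Serre duality with `ω_B ≅ 𝒪_B`) so «`σ²` injective ⟺ `ob²`
surjective» and then `e₂ = rank ob² = rank(σ²ob²) = 12`; `e₁ ≥ rank ob¹ ≥ 8`; Serre `e₃ = e₁`, `e₄ = e₀`, `Ext^{>4} = 0`; HRR with
`td_B = 1` and `ch(E^∨)ch(E)` twist-free. Not constructible in the tree today (no `σ`, `ob`, trace or HRR for `DerivedCategory` Homs).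
[cite: BuchweitzFlenner2008HH, Prop. 6.4.4 and Thm. 6.4.2 (σ ∘ ob = ⌟ch for perfect complexes)]
[cite: BuchweitzFlenner2003, Prop. 4.2 (proof, formula (1): trace commutes with contraction), Cor. 4.3, Def. 4.1 and §5 (I-semiregular)]
[cite: MumfordAV1970, §16 (Riemann–Roch, Serre duality on abelian varieties)] [cite: Markman2025SecantWeil, §8.1, Example 8.2.3 and Question 8.2.4] -/
def SecantSemiregularExtCount : Prop :=
  ∀ (C : ChernCharacterBetti) (d : ℕ) (A B : AbelianVariety ℂ) (π : A ⟶ B) (Θ : CartierDivisor A.X.left)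
    (θ : complexBetti A.X 2), 0 < d → A.dim = 4 → IsIsogeny π → Θ.IsAmple → A.IsPolarizationClassOf Θ θ →
    ∀ (I : Finset ℕ) (E : CochainComplex B.X.left.Modules ℤ) (hE : IsBoundedVBComplex E) (B₀ : complexBetti B.X 2) (x y : ℚ),
      (∀ p : ℕ, p ≤ 4 → p ∈ I) → AdmTwP 4 B.X I E → IsRationalClass B₀ → B₀ ∈ algebraicClasses B.X 1 → x ≠ 0 →
      (∀ p ∈ I, complexBetti.map π.hom.hom.hom (2 * p)
          (expTwistClasses B.X B₀ (fun j => HodgeTheory.chPerfect C B.X E hE.isFiniteLocallyFree j) p) =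
        ((x * secRe d p + y * secIm d p : ℚ) : ℂ) • cupPowTwo θ p) →
      ∃ e₀ e₁ : ℕ, extRank B.X E 0 = e₀ ∧ extRank B.X E 1 = e₁ ∧ extRank B.X E 2 = 12 ∧ 8 ≤ e₁ ∧ e₁ ≤ e₀ + 5

/-- The count forces `3 ≤ dim Hom(E,E)`. [cite: BuchweitzFlenner2008HH, Prop. 6.4.4 and Thm. 6.4.2 (σ ∘ ob = ⌟ch for perfect complexes)] -/
theorem three_le_extRank_zero_of_count {X₀ : SchemeOver ℂ} {E : CochainComplex X₀.left.Modules ℤ}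
    (h : ∃ e₀ e₁ : ℕ, extRank X₀ E 0 = e₀ ∧ extRank X₀ E 1 = e₁ ∧ extRank X₀ E 2 = 12 ∧ 8 ≤ e₁ ∧ e₁ ≤ e₀ + 5) :
    (3 : Cardinal) ≤ extRank X₀ E 0 := by
  obtain ⟨e₀, e₁, h₀, -, -, h8, h5⟩ := h
  rw [h₀]
  have : 3 ≤ e₀ := by omega
  exact_mod_cast this

/-- **K2 — modulo `H`: NO CAPPED SECANT TWISTED OBJECT** on any isogenous quotient `B` of a polarized abelian fourfold `A`, at any level
`d > 0`, for any polarization class `θ` of an ample `Θ`, with `dim Hom(E,E) ≤ r ≤ 2`. This is the typed negative answer to Question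
8.2.4 for every candidate with `Hom = ℂ` (cap `1`) — in particular Markman's `F̄′`. [cite: Markman2025SecantWeil, Question 8.2.4]
[cite: BuchweitzFlenner2008HH, Prop. 6.4.4 and Thm. 6.4.2 (σ ∘ ob = ⌟ch for perfect complexes)] -/
theorem not_hasSecantTwistedObjectOn_cap_of (H : SecantSemiregularExtCount) {r : ℕ} (hr : r ≤ 2) (C : ChernCharacterBetti)
    {d : ℕ} (hd : 0 < d) {A B : AbelianVariety ℂ} (π : A ⟶ B) (hA : A.dim = 4) (hπ : IsIsogeny π)
    {Θ : CartierDivisor A.X.left} (hΘ : Θ.IsAmple) {θ : complexBetti A.X 2} (hθ : A.IsPolarizationClassOf Θ θ) :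
    ¬ HasSecantTwistedObjectOn C (admCap AdmTwP r) d A B π θ := by
  rintro ⟨I, κ, x, y, hI, ⟨E, hE, B₀, ⟨hAdm, hcap⟩, hBr, hBa, hκ⟩, hx, hpin⟩
  have hpin' : ∀ p ∈ I, complexBetti.map π.hom.hom.hom (2 * p)
      (expTwistClasses B.X B₀ (fun j => HodgeTheory.chPerfect C B.X E hE.isFiniteLocallyFree j) p) =
      ((x * secRe d p + y * secIm d p : ℚ) : ℂ) • cupPowTwo θ p := fun p hp => hκ p hp ▸ hpin p hp
  have h3 := three_le_extRank_zero_of_count (H C d A B π Θ θ hd hA hπ hΘ hθ I E hE B₀ x y hI hAdm hBr hBa hx hpin')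
  have h3r : (3 : Cardinal) ≤ (r : Cardinal) := h3.trans hcap
  have : 3 ≤ r := by exact_mod_cast h3r
  omega

/-- **K3 — modulo `H`: for NO genus-4 datum `D` (ANY level `j`) `D.HasSecantObjects C (admCap AdmTwP r)`, `r ≤ 2`** — both quotient maps
`πᵢ : J → J/Gᵢ` are isogenies (`isIsogeny_torsionQuotHom`), `dim J = 4` (`D.dim_J`), `Θ` is ample (`D.principal`), `d = j² > 0`.
[cite: Markman2025SecantWeil, Example 8.2.3 and Question 8.2.4] -/
theorem not_hasSecantObjects_cap_of (H : SecantSemiregularExtCount) {r : ℕ} (hr : r ≤ 2) (C : ChernCharacterBetti)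
    (D : GenusFourSecantDatum) : ¬ D.HasSecantObjects C (admCap AdmTwP r) := by
  rintro ⟨θ₀, hθ, h₁, -⟩
  exact not_hasSecantTwistedObjectOn_cap_of H hr C (pow_pos D.j_pos 2) D.π₁ D.dim_J
    (D.𝒥.J.isIsogeny_torsionQuotHom D.succ_ne_zero D.G₁ D.G₁_le) D.isAmple hθ h₁

/-- **K4 (`C`-free) — modulo `H` the CAPPED rung fails at every `C` and every level.** [cite: Markman2025SecantWeil, Question 8.2.4] -/
theorem not_rung_cap_at_of (H : SecantSemiregularExtCount) {r : ℕ} (hr : r ≤ 2) (C : ChernCharacterBetti) :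
    ¬ ∃ D : GenusFourSecantDatum, D.HasSecantObjects C (admCap AdmTwP r) :=
  fun ⟨D, hD⟩ => not_hasSecantObjects_cap_of H hr C D hD

/-- **K4 — THE REFUTED NATURAL STRENGTHENING OF STUB 1: `stub_rung_secantObjectsQ824` with witnesses of `dim Hom(E,E) ≤ 2` is FALSE
modulo `H ∧ Nonempty ChernCharacterBetti`** (the `∀ C`-head needs one Chern character theory for a literal negation). The strengthening
contains the line's INTENDED witness (Markman's `F̄′`, `Hom = ℂ`) and every simple sheaf / `sigmaAdmissible` complex.
[cite: Markman2025SecantWeil, Question 8.2.4] -/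
theorem stub_rung_cap_false_of (H : SecantSemiregularExtCount) (hC : Nonempty ChernCharacterBetti) {r : ℕ} (hr : r ≤ 2) :
    ¬ ∀ C : ChernCharacterBetti, ∃ D : GenusFourSecantDatum, D.j = 1 ∧ D.HasSecantObjects C (admCap AdmTwP r) :=
  fun h => hC.elim fun C => by
    obtain ⟨D, -, hD⟩ := h C
    exact not_hasSecantObjects_cap_of H hr C D hD

/-- **K5 — the venture's ORIGINAL σ-notion `sigmaAdmissible` (`Hom(E,E) = ℂ` built in, `AmplificationChainSigmaGluable` §1) carries NO
secant objects on any genus-4 datum, modulo `H`.** [cite: BuchweitzFlenner2003, §5 (I-semiregular)] [cite: Markman2025SecantWeil, Question 8.2.4] -/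
theorem not_hasSecantObjects_sigmaAdmissible_of (H : SecantSemiregularExtCount) (C : ChernCharacterBetti)
    (D : GenusFourSecantDatum) : ¬ D.HasSecantObjects C (fun n X₀ I E => sigmaAdmissible n X₀ I E) := fun h =>
  not_hasSecantObjects_cap_of H (le_refl 2) C D <|
    hasSecantObjects_mono (Adm' := admCap AdmTwP 2)
      (fun n X₀ I E hA => ⟨Or.inl (gluableSigmaAdmissible_of_sigmaAdmissible hA), by
        rw [(sigmaAdmissible_iff_gluable_and_extRank_zero.mp hA).2]; norm_num⟩) D h

/-- **K6 — THE UNCAPPED RUNG, REFORMULATED (modulo `H`)**: a secant twisted object for `AdmTwP` on a quotient of a polarized abelian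
fourfold IS one for the notion «`AdmTwP` ∧ `3 ≤ dim Hom(E,E)`» — STUB 1 as typed asks for NON-SIMPLE fully semiregular secant objects
(at `j = 1` even `dim Hom ≥ 4`, `levelOne_four_le_endRank` of the Negative file, using `x ∈ ℤ`). Neither the preprint (whose candidates
`F_d`, `F̄′` have `Hom = ℂ`) nor the cell (NOGO-n4 §6: no construction at `n = 4`) names a candidate in this class.
[cite: Markman2025SecantWeil, Example 8.2.3 and Question 8.2.4] -/
theorem hasSecantTwistedObjectOn_iff_nonsimple_of (H : SecantSemiregularExtCount) (C : ChernCharacterBetti) {d : ℕ} (hd : 0 < d)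
    {A B : AbelianVariety ℂ} (π : A ⟶ B) (hA : A.dim = 4) (hπ : IsIsogeny π) {Θ : CartierDivisor A.X.left} (hΘ : Θ.IsAmple)
    {θ : complexBetti A.X 2} (hθ : A.IsPolarizationClassOf Θ θ) :
    HasSecantTwistedObjectOn C AdmTwP d A B π θ ↔
      HasSecantTwistedObjectOn C (fun n X₀ I E => AdmTwP n X₀ I E ∧ (3 : Cardinal) ≤ extRank X₀ E 0) d A B π θ := by
  refine ⟨?_, hasSecantTwistedObjectOn_mono fun _ _ _ _ h => h.1⟩
  rintro ⟨I, κ, x, y, hI, ⟨E, hE, B₀, hAdm, hBr, hBa, hκ⟩, hx, hpin⟩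
  have hpin' : ∀ p ∈ I, complexBetti.map π.hom.hom.hom (2 * p)
      (expTwistClasses B.X B₀ (fun j => HodgeTheory.chPerfect C B.X E hE.isFiniteLocallyFree j) p) =
      ((x * secRe d p + y * secIm d p : ℚ) : ℂ) • cupPowTwo θ p := fun p hp => hκ p hp ▸ hpin p hp
  have h3 := three_le_extRank_zero_of_count (H C d A B π Θ θ hd hA hπ hΘ hθ I E hE B₀ x y hI hAdm hBr hBa hx hpin')
  exact ⟨I, κ, x, y, hI, ⟨E, hE, B₀, ⟨hAdm, h3⟩, hBr, hBa, hκ⟩, hx, hpin⟩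

/-- K6 at the datum level: modulo `H`, `D.HasSecantObjects C AdmTwP ↔ D.HasSecantObjects C (AdmTwP ∧ 3 ≤ dim Hom)`.
[cite: Markman2025SecantWeil, Example 8.2.3 and Question 8.2.4] -/
theorem hasSecantObjects_iff_nonsimple_of (H : SecantSemiregularExtCount) (C : ChernCharacterBetti) (D : GenusFourSecantDatum) :
    D.HasSecantObjects C AdmTwP ↔
      D.HasSecantObjects C (fun n X₀ I E => AdmTwP n X₀ I E ∧ (3 : Cardinal) ≤ extRank X₀ E 0) := by
  refine ⟨?_, hasSecantObjects_mono (fun _ _ _ _ h => h.1) D⟩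
  rintro ⟨θ₀, hθ, h₁, h₂⟩
  exact ⟨θ₀, hθ,
    (hasSecantTwistedObjectOn_iff_nonsimple_of H C (pow_pos D.j_pos 2) D.π₁ D.dim_J
      (D.𝒥.J.isIsogeny_torsionQuotHom D.succ_ne_zero D.G₁ D.G₁_le) D.isAmple hθ).mp h₁,
    (hasSecantTwistedObjectOn_iff_nonsimple_of H C (pow_pos D.j_pos 2) D.π₂ D.dim_J
      (D.𝒥.J.isIsogeny_torsionQuotHom D.succ_ne_zero D.G₂ D.G₂_le) D.isAmple hθ).mp h₂⟩

/-! ### §D′ The arithmetic, instantiated (kernel-checked; the general lemmas land in `Negative/SecantSemiregularEulerSqueeze.lean`) -/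

/-- The line's secant coefficients times `p!` are the coordinates `(x, y, −dx, −dy, d²x)` used by the Euler form (`d = 1` and general `d`,
degrees `0…4`). [cite: Markman2025SecantWeil, §8.1 (Euler pairing of a secant class, n = 4)] -/
theorem secantCoordinates (d : ℕ) (x y : ℚ) :
    (x * secRe d 0 + y * secIm d 0) * (Nat.factorial 0 : ℚ) = x ∧
    (x * secRe d 1 + y * secIm d 1) * (Nat.factorial 1 : ℚ) = y ∧
    (x * secRe d 2 + y * secIm d 2) * (Nat.factorial 2 : ℚ) = -(d * x) ∧
    (x * secRe d 3 + y * secIm d 3) * (Nat.factorial 3 : ℚ) = -(d * y) ∧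
    (x * secRe d 4 + y * secIm d 4) * (Nat.factorial 4 : ℚ) = d ^ 2 * x := by
  simp only [secRe, secIm, Nat.factorial]
  norm_num [Nat.even_iff]
  refine ⟨?_, ?_, ?_⟩ <;> ring

/-- Euler form of the secant class in these coordinates: `2v₀v₄ − 8v₁v₃ + 6v₂² = 8d(dx² + y²)` (`> 0` for `d > 0`, `x ≠ 0`).
[cite: Markman2025SecantWeil, §8.1 (Euler pairing of a secant class, n = 4)] -/
example (d x y : ℚ) : 2 * x * (d ^ 2 * x) - 8 * y * (-(d * y)) + 6 * (-(d * x)) ^ 2 = 8 * d * (d * x ^ 2 + y ^ 2) := by ring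

/-- Markman's `F̄′` (`e₀ = 1`, `χ = 8d`): the squeeze `χ = 2e₀ − 2e₁ + 12`, `e₁ ≥ 8` is violated at every `d ≥ 1`.
[cite: Markman2025SecantWeil, Question 8.2.4] -/
example (d e₁ : ℤ) (hd : 1 ≤ d) (he₁ : 8 ≤ e₁) : (8 * d : ℤ) ≠ 2 * 1 - 2 * e₁ + 12 := by omega

/-- Level one (`deg π = 2`, `d = 1`, `x² + y² ≥ 1`): `2(2e₀ − 2e₁ + 12) = 8(x²+y²) ≥ 8` with `e₁ ≥ 8` forces `e₀ ≥ 4`; level two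
(`deg π = 5`, `d = 4`): `5(2e₀ − 2e₁ + 12) ≥ 128` forces `e₀ ≥ 15`. [cite: Markman2025SecantWeil, Question 8.2.4] -/
example (e₀ e₁ : ℤ) (he₁ : 8 ≤ e₁) (h : 8 ≤ 2 * (2 * e₀ - 2 * e₁ + 12)) : 4 ≤ e₀ := by omega

example (e₀ e₁ : ℤ) (he₁ : 8 ≤ e₁) (h : 128 ≤ 5 * (2 * e₀ - 2 * e₁ + 12)) : 15 ≤ e₀ := by omega

-- secant_contraction_ranks (this seat, exact over ℚ(i) in ∧^•ℚ⁸; `compute/contraction_ranks.out` in the item's evidence):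
--   class on the secant plane, any d ∈ {1,2,3,4}, any sampled (x,y) ≠ 0, any twist exp(βθ):  (f₁,f₂,f₃,f₄) = (8,12,8,1)
--   pure spinors 1, exp(θ), exp(iθ), θ⁴ (line bundles / points):                              (4, 6, 4, 1)
--   θ² (codimension-2 class):                                                                   (8,18, 8, 1)
--   census of integral classes c ∈ [-2,2]^5: (4,6)×8, (8,12)×72, (8,18)×3044 — 12 is the MINIMUM rank on HT² off the spinor locus.

/-! ## §C What a refutation / a proof of the crux must use -/

/-! ### §D″ The landed kernel facts behind `H` (imported from `Theorems/SheafSeedGaussSq/Negative/`)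
`SecantContractionRankCertificate` (p781975): in the honest split exterior-algebra model of an abelian fourfold the contraction
`ξ ↦ ξ ⌟ κ` has rank `8` on `HT¹` and `12` on `HT²` for the secant classes of the rung (`d = 1`) and of the fallback (`d = 4`), and
rank `4`, `6` for the pure spinor `exp θ` — the table `(8,12 | 4,6)` used in the derivation of `SecantSemiregularExtCount`;
`SecantSemiregularEulerSqueeze` (p780392): the arithmetic of the squeeze and its notion-level consequences. -/

section LandedFacts
open Summit.HodgeConjecture.HodgeConjecture.Theorems.SheafSeedGaussSq.Negative

/-- The certified secant row of the rank table at the rung `(d,x,y) = (1,1,1)`: `(f₁, f₂) = (8, 12)`. [folklore] -/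
example : (M1 (kappaV 1 1 1)).rank = 8 ∧ (M2 (kappaV 1 1 1)).rank = 12 := ⟨rank_M1_d1x1y1, rank_M2_d1x1y1⟩

/-- … at Markman's real part `(1,1,0)` and at the fallback level `d = 4`. [folklore] -/
example : (M2 (kappaV 1 1 0)).rank = 12 ∧ (M2 (kappaV 4 1 1)).rank = 12 ∧ (M1 (kappaV 1 1 0)).rank = 8 ∧ (M1 (kappaV 4 1 1)).rank = 8 :=
  ⟨rank_M2_d1x1y0, rank_M2_d4x1y1, rank_M1_d1x1y0, rank_M1_d4x1y1⟩

/-- The line-bundle sanity row: `exp θ` has `(f₁, f₂) = (4, 6)` (and `χ(L,L) = 0 = 2·1 − 2·4 + 6`). [folklore] -/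
example : (M1 expThetaV).rank = 4 ∧ (M2 expThetaV).rank = 6 := ⟨rank_M1_exp, rank_M2_exp⟩

/-- The landed squeeze: `dim Hom ≤ 2` is incompatible with `e₂ = 12`, `8 ≤ e₁ ≤ e₀ + 5` (signature as landed). [folklore] -/
example := @squeeze_false_of_endRank_le_two

end LandedFacts

/-- **No Chern character theory ⇒ the crux holds vacuously** (`m := 1`). Hence ANY refutation `¬ SheafSeedGaussSq` must first
INHABIT `ChernCharacterBetti` (contrapositive `nonempty_chernCharacterBetti_of_not` below) — the reason no unconditional kill
is typable today. [folklore] -/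
theorem sheafSeedGaussSq_of_isEmpty (h : IsEmpty ChernCharacterBetti) :
    Summit.HodgeConjecture.HodgeConjecture.Theses.EightfoldTwistedSheafSeeds.SheafSeedGaussSq :=
  ⟨1, one_pos, fun C => h.elim C⟩

/-- Contrapositive: a refutation of the crux yields a Chern character theory. [folklore] -/
theorem nonempty_chernCharacterBetti_of_not
    (h : ¬ Summit.HodgeConjecture.HodgeConjecture.Theses.EightfoldTwistedSheafSeeds.SheafSeedGaussSq) :
    Nonempty ChernCharacterBetti := by
  by_contra hC
  exact h (sheafSeedGaussSq_of_isEmpty (not_nonempty_iff.mp hC))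

/-- **(g1) The CAPPED rung at every `C` empties `ChernCharacterBetti`, modulo `H`** (the `C`-content of `stub_rung_cap_false_of`).
[cite: Markman2025SecantWeil, Question 8.2.4] -/
theorem isEmpty_chernCharacterBetti_of_rung_cap (H : SecantSemiregularExtCount) {r : ℕ} (hr : r ≤ 2)
    (hQ : ∀ C : ChernCharacterBetti, ∃ D : GenusFourSecantDatum, D.j = 1 ∧ D.HasSecantObjects C (admCap AdmTwP r)) :
    IsEmpty ChernCharacterBetti :=
  ⟨fun C => by
    obtain ⟨D, -, hD⟩ := hQ C
    exact not_hasSecantObjects_cap_of H hr C D hD⟩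

/-! ## §E (g2) Card `weil-squared-anchor`: kernel-checked pieces of the falsifier run (the numbers live in the module docstring;
the rank certificate `(8,18)` lands separately under `Theorems/SheafSeedGaussSq/Negative/`) -/

section WeilSquaredAnchor
open Summit.HodgeConjecture.HodgeConjecture.Theorems.SheafSeedGaussSq.Negative

/-- **Falsifier (a), kernel-certified (p799944).** The truncated contraction maps of `κ(E₂) = ch Φ(I_p ⊠ I_q^∨)` on
`X₂ × X̂₂` have ranks `(f₁, f₂) = (8, 18) = (e₁, e₂)(E₂)`: the special-point letter `E₂` of card `weil-squared-anchor` is taut and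
fully `σ`-semiregular there (modulo [BuchweitzFlenner2008HH] Prop. 6.4.4 and the Serre-duality transpose, as in §D″). [folklore] -/
example : (M1 kappaE2V).rank = 8 ∧ (M2 kappaE2V).rank = 18 := ⟨rank_M1_kappaE2, rank_M2_kappaE2⟩

/-- The `e₂`-law of the fall-back letters `Φ(I_Z ⊠ I_{Z'}^∨)` (`|Z| = d₁, |Z'| = d₂ ≥ 1`, all with `f₂ = 18`) holds only at
`d₁ = d₂ = 1` (p799944). [folklore] -/
example (d₁ d₂ : ℕ) (h₁ : 1 ≤ d₁) (h₂ : 1 ≤ d₂) :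
    1 * 1 + (2 * d₁ + 2) * (2 * d₂ + 2) + 1 * 1 = 18 ↔ d₁ = 1 ∧ d₂ = 1 := idealPair_e2_law_iff d₁ d₂ h₁ h₂

/-- The matrix `J` of `ψ^*` on a rational `ℚ(i)`-line (`k = 2`, `m = 1`), also used as the alternating Gram matrix `G`. [folklore] -/
def Jmat : Matrix (Fin 2) (Fin 2) ℚ := !![0, -1; 1, 0]

/-- The conjugation `F = diag(1, −1)`. [folklore] -/
def Fmat : Matrix (Fin 2) (Fin 2) ℚ := !![1, 0; 0, -1]

/-- **Falsifier (c) of the card, smallest instance (`k = 2`, `m = 1`, `M = G = J`)**: the hypotheses of leaf (L0)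
`ConjugationAntiIsometry` are met (`J² = −1`, `Jᵀ = −J`, `Jᵀ J J = J`) and `F = diag(1,−1)` is a witness (`F² = 1`, `FJ = −JF`,
`Fᵀ J F = −J`) — the sign conventions of the typed leaf are consistent. [cite: vanGeemen1994HodgeAV, Lemma 5.2] -/
theorem conjugationAntiIsometry_instance_k2 :
    Jmat * Jmat = -(((1 ^ 2 : ℕ) : ℚ) • (1 : Matrix (Fin 2) (Fin 2) ℚ)) ∧ Jmat.transpose = -Jmat ∧
      Jmat.transpose * Jmat * Jmat = ((1 ^ 2 : ℕ) : ℚ) • Jmat ∧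
      Fmat * Fmat = 1 ∧ Fmat * Jmat = -(Jmat * Fmat) ∧ Fmat.transpose * Jmat * Fmat = -Jmat := by
  refine ⟨?_, ?_, ?_, ?_, ?_, ?_⟩ <;>
    (ext i j; fin_cases i <;> fin_cases j <;>
      simp [Jmat, Fmat, Matrix.mul_apply, Fin.sum_univ_two, Matrix.transpose_apply, Matrix.smul_apply])

/-- **(N1-dim) kills the cheapest K3 instance.** For a triangle `L₁ → G → L₂ →⁺¹` with `σ²_G` injective (ω ≅ 𝒪) the vanishing of
`Ext²(L₂,L₁) → Ext²(G,G)` forces `ext²(L₂,L₁) ≤ ext¹(L₁,L₁) + ext¹(L₂,L₂) + ext¹(L₁,L₂)`; for a SELF-extension of a Künneth square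
`L = E ⊠ E′` of `E₂`-type letters (`e(E) = e(E′) = (1,8,18,8,1)`, so `ext¹(L,L) = 16`, `ext²(L,L) = 100`) this reads `100 ≤ 48`.
Counts enter as hypotheses (the categorical step is on paper, module docstring §E). [cite: BuchweitzFlenner2008HH, Prop. 6.4.4 and Thm. 6.4.2 (σ ∘ ob = ⌟ch for perfect complexes)] -/
theorem n1dim_selfExtension_E2sq_false {x₁₁ x₂₂ x₁₂ y : ℕ} (hN1 : y ≤ x₁₁ + x₂₂ + x₁₂)
    (h₁₁ : x₁₁ = 8 * 1 + 1 * 8) (h₂₂ : x₂₂ = 8 * 1 + 1 * 8) (h₁₂ : x₁₂ = 8 * 1 + 1 * 8)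
    (hy : y = 18 * 1 + 8 * 8 + 1 * 18) : False := by
  omega

/-- The `e₂`-law bookkeeping of the letters at the special point: `e₂(E₂) = 18 = f₂`, `e₂(Φ(𝒪 ⊠ I_q^∨)) = 1·1 + 2·4 + 1·1 = 10 = f₂`,
`e₂(Φ(Θ^a ⊠ Θ̂^b)) = 1 + 2·2 + 1 = 6 = f₂`, while `Φ(I_p ⊠ I_Z^∨)` with `|Z| = 2` has `e₂ = 2 + 4·6 = 26 > 18 = f₂` (not semiregular).
[folklore] -/
example : 1 * 1 + 4 * 4 + 1 * 1 = 18 ∧ 1 * 1 + 2 * 4 + 1 * 1 = 10 ∧ 1 * 1 + 2 * 2 + 1 * 1 = 6 ∧ 2 + 4 * 6 = 26 := by norm_num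

/-- The rank law of the linear Künneth pre-test (b), arithmetic shadow: with `k` letters `rank T_h ≤ k − 2`; so `k = 2 ⇒ rank T_h = 0`
and `k = 3 ⇒ rank T_h ≤ 1`. [folklore] -/
example (k r : ℕ) (hk : r + 2 ≤ k) : (k = 2 → r = 0) ∧ (k = 3 → r ≤ 1) := by omega

end WeilSquaredAnchor

/-! ## §G (g2, director req-153 (1)) Statement audit A1–A6 of the crux AS TYPED and tests against the catalogue

Full text: crux file `AUDIT-req153.md` (also attached as evidence `AUDIT_req153_g2.md`). Verdict: 0 blocking, 2 non-blocking remarks —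
(R-i) the two admissibility doors test different strengths ({1,…,8} ⊆ I, full σ, for `gluableSigmaAdmissible`, which receives the
ObjClass index 2·4 = 8; {1,2,3,4} ⊆ I, partial σ_{≤3} on one vector bundle, for `bfSingleAdmissible'`, which ignores the index —
the two typed lemmas below); (R-ii) `∀ C : ChernCharacterBetti` ranges over the ℚ^×-rescaling torsor of the standard Chern character
(no field pins ch₁(L) = c₁(L)), the body is rescaling-covariant (§B), and no instance exists in the tree, so the crux is provable as
intended and refutable only modulo K1 `Nonempty ChernCharacterBetti`. Junk: E = 0 is gluable-admissible (σ on Ext²(0,0) = 0) but then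
w = −q h⁴ ∈ W_K ∩ ℚh⁴ = 0 (characters (x² + m²y²)⁴ vs (x ± imy)⁸ separate at (x,y) = (2,1) — NOT at (1,0), (0,1), (1,1), see the
three `decide`s), contradicting w ≠ 0. Catalogue: `JacobianSecantSeedObstruction` (p796089), `HalfClassParityWallPPAV4` (p796093) and
LAW #2 `SecantClassSemiregularityCount` (p796927) are typed over abstract linear maps / `Theta4 ℚ` on a FOURFOLD and share NO symbol
with `IsISemiregularC` / `gluableSigmaAdmissible`: no kernel contact; through the dictionary they close the Jacobian-letter, odd-theta-letter
and (with (S1′) of §E) the whole Orlov/Künneth-BOX sub-doors of the crux's residual door R4 (eightfold objects); R1/R2/R3 are not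
expressible in the crux's predicate (absolute σ, no group, no weak criterion). `bfSingleAdmissible'` is not vacuous as typed but empty of
candidates (line bundles: w = 0; split bundles: dead by card monomial-design-seed Sketch §2; LAW #2 is a fourfold law). -/

section Req153Audit

/-- **(R-i, bfSingle' door)** With the initial-segment conjunct of `bfSingleAdmissible'` and the crux's `4 ∈ I`, the tested index set
contains `{1,2,3,4}` (and nothing forces more). [cite: BuchweitzFlenner2003, §5 (I-semiregular)] -/
theorem bfSingle'_index_floor {I : Finset ℕ} (hI : I.IsShiftedInitialSegment) (h4 : 4 ∈ I) :
    ∀ p, 1 ≤ p → p ≤ 4 → p ∈ I := by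
  intro p hp1 hp4
  obtain ⟨q, rfl⟩ : ∃ q, p = q + 1 := ⟨p - 1, by omega⟩
  exact hI 3 h4 q (by omega)

/-- **(R-i, gluable door)** `HasSeedOn 𝒪 4 P h w` calls the object class with index `2 · 4 = 8`, so the gluable disjunct demands the FULL
index set `{1,…,8} ⊆ I` (all of σ₀,…,σ₇ jointly injective). [cite: BuchweitzFlenner2003, Def. 4.1 and §5] -/
theorem gluable_index_full {X₀ : Literature.AlgebraicGeometry.Motives.SchemeOver ℂ} {I : Finset ℕ}
    {E : CochainComplex X₀.left.Modules ℤ}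
    (h : Summit.Ventures.HSemireg.gluableSigmaAdmissible (2 * 4) X₀ I E) :
    ∀ p, 1 ≤ p → p ≤ 8 → p ∈ I := fun p h1 _ => h.1 p h1 (by omega)

/-- **(A4 junk E = 0, d = 1)** The eigen-characters of `h⁴` (`(x² + y²)⁴`) and of `W₊` (`(x + iy)⁸`) COINCIDE at `(x,y) = (1,1)` … [folklore] -/
example : (⟨1, 1⟩ : GaussianInt) ^ 8 = ⟨((1 : ℤ) ^ 2 + 1 ^ 2) ^ 4, 0⟩ := by decide

/-- … and at `(0,1)` (`i⁸ = 1`) … [folklore] -/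
example : (⟨0, 1⟩ : GaussianInt) ^ 8 = ⟨((0 : ℤ) ^ 2 + 1 ^ 2) ^ 4, 0⟩ := by decide

/-- … and first SEPARATE at `(2,1)`: `(2+i)⁸ = −527 − 336i ≠ 625 = (2² + 1²)⁴` — so the `∀ x y : ℕ` of `pullbackEigenclasses` is what
keeps `h⁴` out of the Weil plane and excludes the junk witness `E = 0` (`w = −q h⁴`). [folklore] -/
example : (⟨2, 1⟩ : GaussianInt) ^ 8 = ⟨-527, -336⟩ ∧ (⟨2, 1⟩ : GaussianInt) ^ 8 ≠ ⟨((2 : ℤ) ^ 2 + 1 ^ 2) ^ 4, 0⟩ := by decide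

end Req153Audit

-- Targets
-- T1 `SecantQ824.stub_rung_secantObjectsQ824` : INTENDED WITNESS DEAD (cell NEGATIVE #1 Q824-NO: Markman's F̄′ has Hom = ℂ, hence not
--    AdmTwP-admissible at any d); natural strengthening «dim Hom(E,E) ≤ 2» FALSE modulo H at every level (`stub_rung_cap_false_of`,
--    `not_rung_cap_at_of`, `not_hasSecantObjects_sigmaAdmissible_of`); statement as typed NOT refuted — it now asks for NON-SIMPLE fully
--    semiregular secant objects (`hasSecantObjects_iff_nonsimple_of`; at j = 1 dim Hom ≥ 4, at j = 2 ≥ 15), a class with no candidate.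
-- T2 `SecantQ824.stub_transfer_secantQuotientEightfold` : hypothesis class = non-simple objects only (modulo H); the box-product / Orlov
--    transfer needs σ¹-injectivity on the factors as well (cell NOGO-n4 §1 (S1), (vi)), not recorded by `HasSecantObjects` — no kill typed.
-- T3 `Birth.stub_twistedSeedGaussFour`, `Birth.stub_twistedClassCarrierGaussFour` : `∀ C`-headed; intended secant-product witnesses dead
--    by NOGO-n4 §1 (modulo (S1)); no unconditional attack (`sheafSeedGaussSq_of_isEmpty`).
-- T4 (g2) node `WeilSquaredAnchor` (card `weil-squared-anchor`, NO registered line): leaves `ConjugationAntiIsometry` (instance k = 2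
--    checked: `conjugationAntiIsometry_instance_k2`), `AnchorHyperbolic`, `SegreCompatible`, `WeilPlusNeg` — TRUE on paper incl. the
--    junk regimes (h = 0, degenerate G, d = 0, n = 0); K-leaf `WeilSquaredSupply` — OPEN, fenced: letter `E₂` passes (a) [(8,18) =
--    (e₁,e₂), certificate file], gluings obey (N1) [self-extensions of Künneth squares dead: `n1dim_selfExtension_E2sq_false`], the
--    rank law (b) [≥ 4 letters for E₂-type], (S1′) [no Orlov-box supply], and on the eightfold only `e₂ ≥ f₂`.

end Summit.HodgeConjecture.HodgeConjecture.Cruxes.SheafSeedGaussSq.Disproof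

end
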